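import Literature.Probability.LatticeModels.BalabanStepOneFormat

/-!
# Balaban's step-one format — calibration, part 1: the XY Gibbs weight is a coercive symmetric weight

The nearest-neighbour XY Gibbs weight of the (2+1)D block torus,
`xyWeight K θ = exp (-K · misalign θ)` (real, positive), satisfies clauses W1–W4 of
`Literature.Probability.LatticeModels.BalabanStepOne.CoerciveWeight` with coercivity rate `c₀ = 1`
(`xyWeight_coerciveWeight`).  This is the first half of the calibration of the format announced in
`Summits/…/Cruxes/BirGappedPhaseReductionR/SPLIT-PROPOSAL.md` §4(a) (the second half — the
depth-one representation with bond action `K(1 - cos ∂z)` and cluster activities — is the natural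
first `--supports` target of the engine child); it shows in particular that W1–W4 are jointly
satisfiable, by the weight whose slice order is the PROVED reflection-positivity instance of the
engine's conclusion.

Ingredients: invariance of `misalign` under `2π`-shifts of one variable, global phase shifts,
translations, the time reflection `timeRefl` and the spatial inversion `spaceInv` (finite
reindexing of the bond sums).  Folklore.
-/

noncomputable section

open scoped BigOperators ComplexConjugate Classical
open MeasureTheory Complex Filter Finset

namespace Literature.Probability.LatticeModels.BalabanStepOne

variable {L' M : ℕ} [NeZero L'] [NeZero M]

/-- The nearest-neighbour XY Gibbs weight `exp (-K · misalign θ)` of the block torus, as a complex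
weight. [folklore] -/
def xyWeight (K : ℝ) (θ : Site L' M → ℝ) : ℂ := ((Real.exp (-K * misalign θ) : ℝ) : ℂ)

/-! ### The three bond directions -/

omit [NeZero L'] [NeZero M] in
/-- `dir 0 = (e₁, 0)`. [folklore] -/
theorem dir_zero : dir L' M 0 = (![1, 0], 0) := by simp [dir]

omit [NeZero L'] [NeZero M] in
/-- `dir 1 = (e₂, 0)`. [folklore] -/
theorem dir_one : dir L' M 1 = (![0, 1], 0) := by
  simp [dir]

omit [NeZero L'] [NeZero M] in
/-- `dir 2 = (0, 1)` (the temporal direction). [folklore] -/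
theorem dir_two : dir L' M 2 = (0, 1) := by
  have h2 : (2 : Fin 3) ≠ 0 := by decide
  have h2' : (2 : Fin 3) ≠ 1 := by decide
  simp only [dir, h2, h2', if_false]
  ext i <;> simp
  fin_cases i <;> rfl

/-- `misalign` as the sum of its two spatial bond sums and its temporal bond sum. [folklore] -/
theorem misalign_eq_three (θ : Site L' M → ℝ) :
    misalign θ = ∑ s : Site L' M, ((1 - Real.cos (θ (s + (![1, 0], 0)) - θ s)) +
      (1 - Real.cos (θ (s + (![0, 1], 0)) - θ s)) + (1 - Real.cos (θ (s + (0, 1)) - θ s))) := by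
  unfold misalign
  refine Finset.sum_congr rfl fun s _ => ?_
  rw [Fin.sum_univ_three, dir_zero, dir_one, dir_two]

/-! ### Invariances of the misalignment energy -/

omit [NeZero L'] [NeZero M] in
/-- Shifting one variable by `2π` does not change any bond cosine. [folklore] -/
theorem cos_update_two_pi_sub (θ : Site L' M → ℝ) (s₀ a b : Site L' M) :
    Real.cos (Function.update θ s₀ (θ s₀ + 2 * Real.pi) a -
        Function.update θ s₀ (θ s₀ + 2 * Real.pi) b) = Real.cos (θ a - θ b) := by
  by_cases ha : a = s₀ <;> by_cases hb : b = s₀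
  · subst ha; subst hb; simp
  · subst ha
    rw [Function.update_self, Function.update_of_ne hb,
      show θ a + 2 * Real.pi - θ b = (θ a - θ b) + 2 * Real.pi by ring, Real.cos_add_two_pi]
  · subst hb
    rw [Function.update_self, Function.update_of_ne ha,
      show θ a - (θ b + 2 * Real.pi) = (θ a - θ b) - 2 * Real.pi by ring, Real.cos_sub_two_pi]
  · rw [Function.update_of_ne ha, Function.update_of_ne hb]

/-- `misalign` is `2π`-periodic in each variable. [folklore] -/
theorem misalign_update_two_pi (θ : Site L' M → ℝ) (s₀ : Site L' M) :
    misalign (Function.update θ s₀ (θ s₀ + 2 * Real.pi)) = misalign θ := by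
  unfold misalign
  simp_rw [cos_update_two_pi_sub]

/-- `misalign` is invariant under global phase shifts. [folklore] -/
theorem misalign_add_const (θ : Site L' M → ℝ) (a : ℝ) :
    misalign (fun s => θ s + a) = misalign θ := by
  simp [misalign]

/-- `misalign` is translation invariant. [folklore] -/
theorem misalign_transl (θ : Site L' M → ℝ) (t : Site L' M) :
    misalign (fun s => θ (s + t)) = misalign θ := by
  unfold misalign
  have h : ∀ (s : Site L' M) (i : Fin 3), θ (s + dir L' M i + t) = θ ((s + t) + dir L' M i) := by
    intro s i; rw [add_right_comm]
  simp_rw [h]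
  exact Fintype.sum_equiv (Equiv.addRight t) _ _ fun s => rfl

/-- The time reflection as a permutation of the sites. [folklore] -/
def timeReflEquiv : Site L' M ≃ Site L' M where
  toFun := timeRefl
  invFun := timeRefl
  left_inv s := by simp [timeRefl]
  right_inv s := by simp [timeRefl]

/-- The spatial inversion as a permutation of the sites. [folklore] -/
def spaceInvEquiv : Site L' M ≃ Site L' M where
  toFun := spaceInv
  invFun := spaceInv
  left_inv s := by simp [spaceInv]
  right_inv s := by simp [spaceInv]

omit [NeZero L'] [NeZero M] in
/-- Time reflection commutes with spatial bond shifts. [folklore] -/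
theorem timeRefl_add_spatial (s : Site L' M) (v : TorusSite 2 L') :
    timeRefl (s + (v, 0)) = timeRefl s + (v, 0) := by
  ext <;> simp [timeRefl]

omit [NeZero L'] [NeZero M] in
/-- Time reflection reverses the temporal bond shift. [folklore] -/
theorem timeRefl_add_temporal (s : Site L' M) :
    timeRefl (s + (0, 1)) = timeRefl s + (0, -1) := by
  ext <;> simp [timeRefl]; ring

omit [NeZero L'] [NeZero M] in
/-- Spatial inversion reverses spatial bond shifts. [folklore] -/
theorem spaceInv_add_spatial (s : Site L' M) (v : TorusSite 2 L') :
    spaceInv (s + (v, 0)) = spaceInv s + (-v, 0) := by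
  ext <;> simp [spaceInv]; ring

omit [NeZero L'] [NeZero M] in
/-- Spatial inversion commutes with the temporal bond shift. [folklore] -/
theorem spaceInv_add_temporal (s : Site L' M) :
    spaceInv (s + (0, 1)) = spaceInv s + (0, 1) := by
  ext <;> simp [spaceInv]

/-- A backward bond sum equals the forward bond sum (reindex by the shift, then use evenness of
`cos`). [folklore] -/
theorem sum_cos_backward (θ : Site L' M → ℝ) (e : Site L' M) :
    ∑ s : Site L' M, (1 - Real.cos (θ (s + -e) - θ s)) =
      ∑ s : Site L' M, (1 - Real.cos (θ (s + e) - θ s)) := by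
  rw [← Equiv.sum_comp (Equiv.addRight e)]
  refine Finset.sum_congr rfl fun s _ => ?_
  simp only [Equiv.coe_addRight, add_neg_cancel_right]
  rw [← Real.cos_neg, neg_sub]

/-- `misalign` is invariant under the time reflection. [folklore] -/
theorem misalign_timeRefl (θ : Site L' M → ℝ) :
    misalign (fun s => θ (timeRefl s)) = misalign θ := by
  rw [misalign_eq_three, misalign_eq_three]
  simp_rw [timeRefl_add_spatial, timeRefl_add_temporal]
  rw [show (∑ s : Site L' M, ((1 - Real.cos (θ (timeRefl s + (![1, 0], 0)) - θ (timeRefl s))) +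
      (1 - Real.cos (θ (timeRefl s + (![0, 1], 0)) - θ (timeRefl s))) +
      (1 - Real.cos (θ (timeRefl s + (0, -1)) - θ (timeRefl s))))) =
      ∑ s : Site L' M, ((1 - Real.cos (θ (s + (![1, 0], 0)) - θ s)) +
      (1 - Real.cos (θ (s + (![0, 1], 0)) - θ s)) + (1 - Real.cos (θ (s + (0, -1)) - θ s)))
      from Equiv.sum_comp timeReflEquiv (fun s => (1 - Real.cos (θ (s + (![1, 0], 0)) - θ s)) +
      (1 - Real.cos (θ (s + (![0, 1], 0)) - θ s)) + (1 - Real.cos (θ (s + (0, -1)) - θ s)))]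
  simp only [Finset.sum_add_distrib]
  congr 1
  have := sum_cos_backward θ ((0 : TorusSite 2 L'), (1 : ZMod M))
  simpa using this

/-- `misalign` is invariant under the spatial inversion. [folklore] -/
theorem misalign_spaceInv (θ : Site L' M → ℝ) :
    misalign (fun s => θ (spaceInv s)) = misalign θ := by
  rw [misalign_eq_three, misalign_eq_three]
  simp_rw [spaceInv_add_spatial, spaceInv_add_temporal]
  rw [show (∑ s : Site L' M, ((1 - Real.cos (θ (spaceInv s + (-![1, 0], 0)) - θ (spaceInv s))) +
      (1 - Real.cos (θ (spaceInv s + (-![0, 1], 0)) - θ (spaceInv s))) +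
      (1 - Real.cos (θ (spaceInv s + (0, 1)) - θ (spaceInv s))))) =
      ∑ s : Site L' M, ((1 - Real.cos (θ (s + (-![1, 0], 0)) - θ s)) +
      (1 - Real.cos (θ (s + (-![0, 1], 0)) - θ s)) + (1 - Real.cos (θ (s + (0, 1)) - θ s)))
      from Equiv.sum_comp spaceInvEquiv (fun s => (1 - Real.cos (θ (s + (-![1, 0], 0)) - θ s)) +
      (1 - Real.cos (θ (s + (-![0, 1], 0)) - θ s)) + (1 - Real.cos (θ (s + (0, 1)) - θ s)))]
  simp only [Finset.sum_add_distrib]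
  have h1 := sum_cos_backward θ ((![1, 0] : TorusSite 2 L'), (0 : ZMod M))
  have h2 := sum_cos_backward θ ((![0, 1] : TorusSite 2 L'), (0 : ZMod M))
  simp only [Prod.neg_mk, neg_zero] at h1 h2
  rw [h1, h2]

/-! ### The XY weight is a coercive symmetric weight with rate `c₀ = 1` -/

/-- Continuity of the misalignment energy. [folklore] -/
theorem continuous_misalign : Continuous (misalign : (Site L' M → ℝ) → ℝ) := by
  unfold misalign
  fun_prop

/-- **Calibration, part 1.** The XY Gibbs weight `exp (-K·misalign)` satisfies W1–W4 of
`CoerciveWeight` with coercivity rate `c₀ = 1` (for every real `K`). [folklore] -/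
theorem xyWeight_coerciveWeight (K : ℝ) : CoerciveWeight K 1 L' M (xyWeight (L' := L') (M := M) K) where
  cont := by
    unfold xyWeight
    exact Complex.continuous_ofReal.comp
      (Real.continuous_exp.comp (continuous_const.mul continuous_misalign))
  periodic θ s := by simp [xyWeight, misalign_update_two_pi]
  u1 θ a := by simp [xyWeight, misalign_add_const]
  transl θ t := by simp [xyWeight, misalign_transl]
  reflHerm θ := by
    simp only [xyWeight, misalign_timeRefl, Complex.conj_ofReal]
  inversion θ := by simp only [xyWeight, misalign_spaceInv]
  norm0 := by simp [xyWeight, misalign]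
  coercive θ := by
    simp only [xyWeight, Complex.norm_real, Real.norm_eq_abs, Real.abs_exp, one_mul]
    exact le_of_eq (by ring_nf)

end Literature.Probability.LatticeModels.BalabanStepOne

end
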